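import Summits.NavierStokesRegularity.OSWSelfSimilar.SheetRResolventBounds
import HarnessLib

/-!
# SHEET-ℝ frame: compactly supported cutoffs approximate every energy-space element IN THE ENERGY NORM, and the cutoff inequality
# with a BOUNDED PERTURBATION `K : E → L²_w` (towards the resolvent of cert-1's full operator `A_F = B_λ − P + F`)

HONEST FRAMING (cell ns-blowup GROUP B / zone Z3, case Z3-SR-SPEC, PAPER item (P1) for the FULL linearisation `A_F = DG(Ω̄) + F` of
SHEET-R-SPEC-PRICE-impl1 (S1): `DG(Ω̄) = B_λ − P`, `P` the bounded non-local part, `F` rank one; 1-D MODEL certificate frame (viscous gCLM/OSW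
sheet on the line); not Euler/NS; «violates: none — MODEL»). Nothing here asserts that a profile exists; the perturbation `K` is an ARBITRARY
bounded real operator `Esp L hL →L[ℝ] W L` and every coercivity constant is a HYPOTHESIS.

The files `SheetRLinearised*` / `SheetRResolvent*` treat the LOCAL operator `−∂² + d∂ + V`.  cert-1's spectral certificate is keyed on the
resolvent of `A_F = (−∂² + d∂ + V) + K`, `K := −P + F` bounded `E → L²_w` and `A_F` coercive as a whole ((S1)).  Lions' existence step goes
through verbatim for the perturbed weak form `linForm(u; φ) + ∫ w (Kp) φ`; the UNIQUENESS step needs one more ingredient, proved here: the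
cutoff tests `χ_R u` converge to `u` in the ENERGY norm (not only in `L²_w`), so the commutator `K(χ_R u) − χ_R K(u)` tends to zero:

* `sq_norm_jmap_cutoff_sub_le` — for `p ∈ Esp` with profile `u`, `‖jmap (χ_R u) − p‖²_E ≤ (¼ + 2M²)·∫_{R²≤ξ²} w u² + 2∫_{R²≤ξ²} w u₁²` (`R ≥ 1`);
* `abs_commutator_le` — `|∫ w (g′ − χ_R g)(χ_R u)| ≤ (‖g′ − g‖_w + (∫_{R²≤ξ²} w g²)^{1/2})·‖u‖_w` for `g, g′ ∈ L²_w` (applied to `g = Kp`, `g′ = K(jmap(χ_R u))`);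
* `cutoff_ineq_K` — **the perturbed cutoff inequality**: if `κ‖jmap τ‖² ≤ linForm(τ; τ) + ∫ w K(jmap τ) τ` on tests, then for every `p ∈ Esp`,
  `R = n + 1`:  `κ/4·∫_{ξ²<R²} w u² ≤ [linForm(u; χ_R²u) + ∫ w (Kp) χ_R²u] + C·tail_u(R) + err(R)` with `err(R) → 0` (`tendsto_err`).

The consequences (uniqueness and pivot bounds for the perturbed scalar / pair problems, the perturbed resolvent) are the next files.
Pure functional analysis; no definition, no named fact.  WHAT THIS IS NOT: not NS; no number of record moves.
-/

noncomputable section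

namespace Summit.NavierStokesRegularity.OSWSelfSimilar
namespace SheetRCutoffApproximation

open _root_.MeasureTheory _root_.Set _root_.Filter _root_.Real SheetRWeakProfilePV SheetRWeakToStrong SheetREnergyClass SheetRWeightedMeasure
  SheetRLinearisedTests SheetREnergySpace SheetRTestSpace SheetRLinearisedFormBounds SheetRSolutionOperator SheetRLinearisedCutoffEstimates
  SheetRLinearisedCutoffEnergy SheetRLinearisedUniqueness SheetRResolventPair SheetRComplexPivot
open scoped Topology ENNReal

variable {L : ℝ}

/-! ### §1 Two weighted tail estimates -/

/-- `∫ w ((1 − χ_R) f)² ≤ ∫_{R² ≤ ξ²} w f²` (`R > 0`; `χ_R = 1` on the plateau, `0 ≤ χ_R ≤ 1`). [folklore] -/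
theorem weightedSq_one_sub_cutoff_mul_le {R : ℝ} (hR : 0 < R) {f : ℝ → ℝ} (hfm : AEStronglyMeasurable f volume)
    (hf : Integrable fun y => (L ^ 2 + y ^ 2) * f y ^ 2) :
    Integrable (fun y => (L ^ 2 + y ^ 2) * ((1 - cutoff R y) * f y) ^ 2) ∧
      ∫ y, (L ^ 2 + y ^ 2) * ((1 - cutoff R y) * f y) ^ 2 ≤ ∫ y in {ξ : ℝ | R ^ 2 ≤ ξ ^ 2}, (L ^ 2 + y ^ 2) * f y ^ 2 := by
  have hmeas : MeasurableSet {ξ : ℝ | R ^ 2 ≤ ξ ^ 2} := measurableSet_le measurable_const (by fun_prop)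
  have hχc : Continuous (cutoff R) := (contDiff_cutoff R).continuous
  have hle : ∀ y, (L ^ 2 + y ^ 2) * ((1 - cutoff R y) * f y) ^ 2 ≤ {ξ : ℝ | R ^ 2 ≤ ξ ^ 2}.indicator (fun y => (L ^ 2 + y ^ 2) * f y ^ 2) y := by
    intro y
    by_cases hy : y ∈ {ξ : ℝ | R ^ 2 ≤ ξ ^ 2}
    · rw [indicator_of_mem hy]
      obtain ⟨h0, h1⟩ := cutoff_nonneg_le_one R y
      have : (1 - cutoff R y) ^ 2 ≤ 1 := by nlinarith
      have hw : 0 ≤ (L ^ 2 + y ^ 2) * f y ^ 2 := by positivity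
      calc (L ^ 2 + y ^ 2) * ((1 - cutoff R y) * f y) ^ 2 = (1 - cutoff R y) ^ 2 * ((L ^ 2 + y ^ 2) * f y ^ 2) := by ring
        _ ≤ 1 * ((L ^ 2 + y ^ 2) * f y ^ 2) := mul_le_mul_of_nonneg_right this hw
        _ = _ := one_mul _
    · rw [indicator_of_notMem hy]
      simp only [mem_setOf_eq, not_le] at hy
      rw [cutoff_eq_one hR hy.le]; simp
  have hint : Integrable (fun y => (L ^ 2 + y ^ 2) * ((1 - cutoff R y) * f y) ^ 2) :=
    (hf.indicator hmeas).mono' ((by fun_prop : AEStronglyMeasurable (fun y : ℝ => L ^ 2 + y ^ 2) volume).mul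
      (((continuous_const.sub hχc).aestronglyMeasurable.mul hfm).pow 2))
      (Eventually.of_forall fun y => by rw [Real.norm_eq_abs, abs_of_nonneg (by positivity)]; exact hle y)
  refine ⟨hint, ?_⟩
  rw [← integral_indicator hmeas]
  exact integral_mono hint (hf.indicator hmeas) hle

/-- `∫ w (χ_R′ u)² ≤ M²·∫_{R² ≤ ξ²} w u²` for `R ≥ 1` and `|χ_R′| ≤ M/R` (`χ_R′ = 0` on the plateau). [folklore] -/
theorem weightedSq_deriv_cutoff_mul_le {R M : ℝ} (hR : 1 ≤ R) (hM0 : 0 ≤ M) (hM : ∀ ξ : ℝ, |deriv (cutoff R) ξ| ≤ M / R) {u : ℝ → ℝ}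
    (hum : AEStronglyMeasurable u volume) (h0 : Integrable fun y => (L ^ 2 + y ^ 2) * u y ^ 2) :
    Integrable (fun y => (L ^ 2 + y ^ 2) * (deriv (cutoff R) y * u y) ^ 2) ∧
      ∫ y, (L ^ 2 + y ^ 2) * (deriv (cutoff R) y * u y) ^ 2 ≤ M ^ 2 * ∫ y in {ξ : ℝ | R ^ 2 ≤ ξ ^ 2}, (L ^ 2 + y ^ 2) * u y ^ 2 := by
  have hR0 : 0 < R := by linarith
  have hmeas : MeasurableSet {ξ : ℝ | R ^ 2 ≤ ξ ^ 2} := measurableSet_le measurable_const (by fun_prop)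
  have hχ'c : Continuous (deriv (cutoff R)) := (hasDerivAt_cutoff R 0).2
  have hχ'b : ∀ ξ, |deriv (cutoff R) ξ| ≤ M := fun ξ => (hM ξ).trans (div_le_self hM0 hR)
  have hle : ∀ y, (L ^ 2 + y ^ 2) * (deriv (cutoff R) y * u y) ^ 2 ≤
      M ^ 2 * {ξ : ℝ | R ^ 2 ≤ ξ ^ 2}.indicator (fun y => (L ^ 2 + y ^ 2) * u y ^ 2) y := by
    intro y
    by_cases hy : y ∈ {ξ : ℝ | R ^ 2 ≤ ξ ^ 2}
    · rw [indicator_of_mem hy]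
      have hsq : deriv (cutoff R) y ^ 2 ≤ M ^ 2 := by
        have := hχ'b y
        rw [← sq_abs]; exact pow_le_pow_left₀ (abs_nonneg _) this 2
      have hw : 0 ≤ (L ^ 2 + y ^ 2) * u y ^ 2 := by positivity
      calc (L ^ 2 + y ^ 2) * (deriv (cutoff R) y * u y) ^ 2 = deriv (cutoff R) y ^ 2 * ((L ^ 2 + y ^ 2) * u y ^ 2) := by ring
        _ ≤ M ^ 2 * ((L ^ 2 + y ^ 2) * u y ^ 2) := mul_le_mul_of_nonneg_right hsq hw
    · rw [indicator_of_notMem hy]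
      simp only [mem_setOf_eq, not_le] at hy
      rw [deriv_cutoff_eq_zero_of_lt hR0 hy]; simp
  have hint : Integrable (fun y => (L ^ 2 + y ^ 2) * (deriv (cutoff R) y * u y) ^ 2) :=
    ((h0.indicator hmeas).const_mul (M ^ 2)).mono' ((by fun_prop : AEStronglyMeasurable (fun y : ℝ => L ^ 2 + y ^ 2) volume).mul
      ((hχ'c.aestronglyMeasurable.mul hum).pow 2))
      (Eventually.of_forall fun y => by rw [Real.norm_eq_abs, abs_of_nonneg (by positivity)]; exact hle y)
  refine ⟨hint, ?_⟩
  rw [← integral_indicator hmeas, ← integral_const_mul]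
  exact integral_mono hint ((h0.indicator hmeas).const_mul _) hle

/-! ### §2 Cutoffs approximate in the energy norm -/

/-- **Energy-norm cutoff approximation.** For `p ∈ Esp` with profile `u = prim (der p)`, `u₁ = der p`, `R ≥ 1`, `|χ_R′| ≤ M/R`: the test
`τ_R = (χ_R u, χ_R′u + χ_R u₁)` satisfies `‖jmap τ_R − p‖² ≤ (¼ + 2M²)·∫_{R²≤ξ²} w u² + 2·∫_{R²≤ξ²} w u₁²`. [folklore] -/
theorem sq_norm_jmap_cutoff_sub_le (hL : 0 < L) (p : Esp L hL) {R M : ℝ} (hR : 1 ≤ R) (hM0 : 0 ≤ M)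
    (hM : ∀ ξ : ℝ, |deriv (cutoff R) ξ| ≤ M / R)
    (hτ : IsCompactTest (fun ξ => cutoff R ξ * prim (der p) ξ) (fun ξ => deriv (cutoff R) ξ * prim (der p) ξ + cutoff R ξ * der p ξ)) :
    ‖jmap hL ⟨(fun ξ => cutoff R ξ * prim (der p) ξ, fun ξ => deriv (cutoff R) ξ * prim (der p) ξ + cutoff R ξ * der p ξ), hτ⟩ - p‖ ^ 2 ≤
      (1 / 4 + 2 * M ^ 2) * (∫ y in {ξ : ℝ | R ^ 2 ≤ ξ ^ 2}, (L ^ 2 + y ^ 2) * prim (der p) y ^ 2)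
        + 2 * ∫ y in {ξ : ℝ | R ^ 2 ≤ ξ ^ 2}, (L ^ 2 + y ^ 2) * der p y ^ 2 := by
  have hR0 : 0 < R := by linarith
  obtain ⟨hum, hu₁m, h0, h1, -, -⟩ := profile_facts hL p
  -- the two components of `jmap τ − p`, a.e.
  have hn : ‖jmap hL ⟨(fun ξ => cutoff R ξ * prim (der p) ξ, fun ξ => deriv (cutoff R) ξ * prim (der p) ξ + cutoff R ξ * der p ξ), hτ⟩ - p‖ ^ 2 =
      ‖(((jmap hL ⟨(fun ξ => cutoff R ξ * prim (der p) ξ, fun ξ => deriv (cutoff R) ξ * prim (der p) ξ + cutoff R ξ * der p ξ), hτ⟩ - p : Esp L hL) : WithLp 2 (W L × W L)).fst : W L)‖ ^ 2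
        + ‖(((jmap hL ⟨(fun ξ => cutoff R ξ * prim (der p) ξ, fun ξ => deriv (cutoff R) ξ * prim (der p) ξ + cutoff R ξ * der p ξ), hτ⟩ - p : Esp L hL) : WithLp 2 (W L × W L)).snd : W L)‖ ^ 2 := by
    rw [← WithLp.prod_norm_sq_eq_of_L2]; rfl
  have hfst_ae : ((((jmap hL ⟨(fun ξ => cutoff R ξ * prim (der p) ξ, fun ξ => deriv (cutoff R) ξ * prim (der p) ξ + cutoff R ξ * der p ξ), hτ⟩ - p : Esp L hL) : WithLp 2 (W L × W L)).fst : W L) : ℝ → ℝ) =ᵐ[volume]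
      fun y => -(1 / 2) * ((1 - cutoff R y) * prim (der p) y) := by
    have e : (((jmap hL ⟨(fun ξ => cutoff R ξ * prim (der p) ξ, fun ξ => deriv (cutoff R) ξ * prim (der p) ξ + cutoff R ξ * der p ξ), hτ⟩ - p : Esp L hL) : WithLp 2 (W L × W L)).fst : W L) =
        ((jmap hL ⟨(fun ξ => cutoff R ξ * prim (der p) ξ, fun ξ => deriv (cutoff R) ξ * prim (der p) ξ + cutoff R ξ * der p ξ), hτ⟩ : Esp L hL) : WithLp 2 (W L × W L)).fst - ((p : Esp L hL) : WithLp 2 (W L × W L)).fst := by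
      rw [Submodule.coe_sub, WithLp.sub_fst]
    rw [e, jmap_fst]
    filter_upwards [ae_volume_of_ae_μw hL (Lp.coeFn_sub ((1 / 2 : ℝ) • (memLp_W_of_isCompactTest (L := L) hτ).1.toLp _)
        (((p : Esp L hL) : WithLp 2 (W L × W L)).fst : W L)),
      ae_volume_of_ae_μw hL (Lp.coeFn_smul (1 / 2 : ℝ) ((memLp_W_of_isCompactTest (L := L) hτ).1.toLp _)),
      ae_volume_of_ae_μw hL (MemLp.coeFn_toLp (memLp_W_of_isCompactTest (L := L) hτ).1), prim_snd_ae_eq hL p]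
      with y h1 h2 h3 h4
    rw [h1, Pi.sub_apply, h2, Pi.smul_apply, h3, smul_eq_mul]
    have : (((p : Esp L hL) : WithLp 2 (W L × W L)).fst : ℝ → ℝ) y = 1 / 2 * prim (der p) y := by
      rw [der_def]; linarith
    rw [this]; ring
  have hsnd_ae : ((((jmap hL ⟨(fun ξ => cutoff R ξ * prim (der p) ξ, fun ξ => deriv (cutoff R) ξ * prim (der p) ξ + cutoff R ξ * der p ξ), hτ⟩ - p : Esp L hL) : WithLp 2 (W L × W L)).snd : W L) : ℝ → ℝ) =ᵐ[volume]
      fun y => deriv (cutoff R) y * prim (der p) y + -((1 - cutoff R y) * der p y) := by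
    have e : (((jmap hL ⟨(fun ξ => cutoff R ξ * prim (der p) ξ, fun ξ => deriv (cutoff R) ξ * prim (der p) ξ + cutoff R ξ * der p ξ), hτ⟩ - p : Esp L hL) : WithLp 2 (W L × W L)).snd : W L) =
        ((jmap hL ⟨(fun ξ => cutoff R ξ * prim (der p) ξ, fun ξ => deriv (cutoff R) ξ * prim (der p) ξ + cutoff R ξ * der p ξ), hτ⟩ : Esp L hL) : WithLp 2 (W L × W L)).snd - ((p : Esp L hL) : WithLp 2 (W L × W L)).snd := by
      rw [Submodule.coe_sub, WithLp.sub_snd]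
    rw [e, jmap_snd]
    filter_upwards [ae_volume_of_ae_μw hL (Lp.coeFn_sub ((memLp_W_of_isCompactTest (L := L) hτ).2.toLp _)
        (((p : Esp L hL) : WithLp 2 (W L × W L)).snd : W L)),
      ae_volume_of_ae_μw hL (MemLp.coeFn_toLp (memLp_W_of_isCompactTest (L := L) hτ).2)] with y h1 h2
    rw [h1, Pi.sub_apply, h2, der_def]; ring
  -- the two tail estimates
  obtain ⟨hi0, hle0⟩ := weightedSq_one_sub_cutoff_mul_le (L := L) hR0 hum h0
  obtain ⟨hi1, hle1⟩ := weightedSq_one_sub_cutoff_mul_le (L := L) hR0 hu₁m h1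
  obtain ⟨hid, hled⟩ := weightedSq_deriv_cutoff_mul_le (L := L) hR hM0 hM hum h0
  have hfst : ‖(((jmap hL ⟨(fun ξ => cutoff R ξ * prim (der p) ξ, fun ξ => deriv (cutoff R) ξ * prim (der p) ξ + cutoff R ξ * der p ξ), hτ⟩ - p : Esp L hL) : WithLp 2 (W L × W L)).fst : W L)‖ ^ 2 =
      1 / 4 * ∫ y, (L ^ 2 + y ^ 2) * ((1 - cutoff R y) * prim (der p) y) ^ 2 := by
    rw [sq_norm_W, ← integral_const_mul]
    refine integral_congr_ae (hfst_ae.mono fun y hy => ?_)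
    simp only [hy]; ring
  have hsnd : ‖(((jmap hL ⟨(fun ξ => cutoff R ξ * prim (der p) ξ, fun ξ => deriv (cutoff R) ξ * prim (der p) ξ + cutoff R ξ * der p ξ), hτ⟩ - p : Esp L hL) : WithLp 2 (W L × W L)).snd : W L)‖ ^ 2 ≤
      2 * (∫ y, (L ^ 2 + y ^ 2) * (deriv (cutoff R) y * prim (der p) y) ^ 2) + 2 * ∫ y, (L ^ 2 + y ^ 2) * ((1 - cutoff R y) * der p y) ^ 2 := by
    rw [sq_norm_W, ← integral_const_mul, ← integral_const_mul, ← integral_add (hid.const_mul 2) (hi1.const_mul 2)]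
    refine integral_mono_ae ?_ ((hid.const_mul 2).add (hi1.const_mul 2)) (hsnd_ae.mono fun y hy => ?_)
    · exact (weightedSq_of_W hL _)
    · simp only [hy]
      have hw : 0 ≤ L ^ 2 + y ^ 2 := by positivity
      nlinarith [mul_nonneg hw (sq_nonneg (deriv (cutoff R) y * prim (der p) y + (1 - cutoff R y) * der p y)),
        mul_nonneg hw (sq_nonneg (deriv (cutoff R) y * prim (der p) y - (1 - cutoff R y) * der p y))]
  rw [hn, hfst]
  have hnn : 0 ≤ ∫ y, (L ^ 2 + y ^ 2) * ((1 - cutoff R y) * prim (der p) y) ^ 2 := integral_nonneg fun y => by positivity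
  nlinarith [hle0, hle1, hled]

/-! ### §3 The commutator term -/

/-- **Commutator bound.** For `g, g′ ∈ L²_w`, a continuous `u` with `∫wu² < ∞` and `R > 0`:
`|∫ w (g′ − χ_R g)(χ_R u)| ≤ (‖g′ − g‖ + (∫_{R²≤ξ²} w g²)^{1/2})·(∫ w u²)^{1/2}`. [folklore] -/
theorem abs_commutator_le (hL : 0 < L) {R : ℝ} (hR : 0 < R) (g g' : W L) {u : ℝ → ℝ} (huc : Continuous u)
    (h0 : Integrable fun y => (L ^ 2 + y ^ 2) * u y ^ 2) :
    Integrable (fun y => (L ^ 2 + y ^ 2) * (((g' : ℝ → ℝ) y - cutoff R y * (g : ℝ → ℝ) y) * (cutoff R y * u y))) ∧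
      |∫ y, (L ^ 2 + y ^ 2) * (((g' : ℝ → ℝ) y - cutoff R y * (g : ℝ → ℝ) y) * (cutoff R y * u y))| ≤
        (‖g' - g‖ + Real.sqrt (∫ y in {ξ : ℝ | R ^ 2 ≤ ξ ^ 2}, (L ^ 2 + y ^ 2) * (g : ℝ → ℝ) y ^ 2))
          * Real.sqrt (∫ y, (L ^ 2 + y ^ 2) * u y ^ 2) := by
  have hχc : Continuous (cutoff R) := (contDiff_cutoff R).continuous
  obtain ⟨hχu_int, hχu_le⟩ := (plateau_mass_le (L := L) hR huc h0)
  have hχu_le' : ∫ y, (L ^ 2 + y ^ 2) * (cutoff R y * u y) ^ 2 ≤ ∫ y, (L ^ 2 + y ^ 2) * u y ^ 2 := by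
    refine integral_mono hχu_int h0 fun y => ?_
    obtain ⟨h0', h1'⟩ := cutoff_nonneg_le_one R y
    have : cutoff R y ^ 2 ≤ 1 := by nlinarith
    have hw : 0 ≤ (L ^ 2 + y ^ 2) * u y ^ 2 := by positivity
    calc (L ^ 2 + y ^ 2) * (cutoff R y * u y) ^ 2 = cutoff R y ^ 2 * ((L ^ 2 + y ^ 2) * u y ^ 2) := by ring
      _ ≤ 1 * ((L ^ 2 + y ^ 2) * u y ^ 2) := mul_le_mul_of_nonneg_right this hw
      _ = _ := one_mul _
  have hχum : AEStronglyMeasurable (fun y => cutoff R y * u y) volume := (hχc.mul huc).aestronglyMeasurable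
  -- split `g′ − χg = (g′ − g) + (1 − χ)g`
  have hdm : AEStronglyMeasurable (fun y => ((g' - g : W L) : ℝ → ℝ) y) volume := aestronglyMeasurable_of_W hL _
  have hd0 := weightedSq_of_W hL (g' - g)
  obtain ⟨htail_int, htail_le⟩ := weightedSq_one_sub_cutoff_mul_le (L := L) hR (aestronglyMeasurable_of_W hL g) (weightedSq_of_W hL g)
  have htm : AEStronglyMeasurable (fun y => (1 - cutoff R y) * (g : ℝ → ℝ) y) volume :=
    (continuous_const.sub hχc).aestronglyMeasurable.mul (aestronglyMeasurable_of_W hL g)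
  obtain ⟨hi1, hb1⟩ := integral_weight_abs_mul_le (L := L) hdm hχum hd0 hχu_int
  obtain ⟨hi2, hb2⟩ := integral_weight_abs_mul_le (L := L) htm hχum htail_int hχu_int
  have hdiff_ae : (fun y => ((g' - g : W L) : ℝ → ℝ) y) =ᵐ[volume] fun y => (g' : ℝ → ℝ) y - (g : ℝ → ℝ) y :=
    ae_volume_of_ae_μw hL (Lp.coeFn_sub g' g)
  -- integrability of the commutator integrand
  have hint : Integrable (fun y => (L ^ 2 + y ^ 2) * (((g' : ℝ → ℝ) y - cutoff R y * (g : ℝ → ℝ) y) * (cutoff R y * u y))) := by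
    have hsum : Integrable (fun y => (L ^ 2 + y ^ 2) * (((g' - g : W L) : ℝ → ℝ) y * (cutoff R y * u y))
        + (L ^ 2 + y ^ 2) * (((1 - cutoff R y) * (g : ℝ → ℝ) y) * (cutoff R y * u y))) := by
      refine (hi1.mono' ?_ ?_).add (hi2.mono' ?_ ?_)
      · exact (by fun_prop : AEStronglyMeasurable (fun y : ℝ => L ^ 2 + y ^ 2) volume).mul (hdm.mul hχum)
      · exact Eventually.of_forall fun y => by
          rw [Real.norm_eq_abs, abs_mul, abs_of_nonneg (by positivity : (0:ℝ) ≤ L ^ 2 + y ^ 2)]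
      · exact (by fun_prop : AEStronglyMeasurable (fun y : ℝ => L ^ 2 + y ^ 2) volume).mul (htm.mul hχum)
      · exact Eventually.of_forall fun y => by
          rw [Real.norm_eq_abs, abs_mul, abs_of_nonneg (by positivity : (0:ℝ) ≤ L ^ 2 + y ^ 2)]
    refine hsum.congr (hdiff_ae.mono fun y hy => ?_)
    simp only [hy]; ring
  refine ⟨hint, ?_⟩
  have hsplit : ∫ y, (L ^ 2 + y ^ 2) * (((g' : ℝ → ℝ) y - cutoff R y * (g : ℝ → ℝ) y) * (cutoff R y * u y)) =
      (∫ y, (L ^ 2 + y ^ 2) * (((g' - g : W L) : ℝ → ℝ) y * (cutoff R y * u y)))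
        + ∫ y, (L ^ 2 + y ^ 2) * (((1 - cutoff R y) * (g : ℝ → ℝ) y) * (cutoff R y * u y)) := by
    have hI1 : Integrable (fun y => (L ^ 2 + y ^ 2) * (((g' - g : W L) : ℝ → ℝ) y * (cutoff R y * u y))) :=
      hi1.mono' ((by fun_prop : AEStronglyMeasurable (fun y : ℝ => L ^ 2 + y ^ 2) volume).mul (hdm.mul hχum))
        (Eventually.of_forall fun y => by rw [Real.norm_eq_abs, abs_mul, abs_of_nonneg (by positivity : (0:ℝ) ≤ L ^ 2 + y ^ 2)])
    have hI2 : Integrable (fun y => (L ^ 2 + y ^ 2) * (((1 - cutoff R y) * (g : ℝ → ℝ) y) * (cutoff R y * u y))) :=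
      hi2.mono' ((by fun_prop : AEStronglyMeasurable (fun y : ℝ => L ^ 2 + y ^ 2) volume).mul (htm.mul hχum))
        (Eventually.of_forall fun y => by rw [Real.norm_eq_abs, abs_mul, abs_of_nonneg (by positivity : (0:ℝ) ≤ L ^ 2 + y ^ 2)])
    rw [← integral_add hI1 hI2]
    refine integral_congr_ae (hdiff_ae.mono fun y hy => ?_)
    simp only [hy]; ring
  have habs1 : |∫ y, (L ^ 2 + y ^ 2) * (((g' - g : W L) : ℝ → ℝ) y * (cutoff R y * u y))| ≤
      ‖g' - g‖ * Real.sqrt (∫ y, (L ^ 2 + y ^ 2) * u y ^ 2) := by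
    have h1 : |∫ y, (L ^ 2 + y ^ 2) * (((g' - g : W L) : ℝ → ℝ) y * (cutoff R y * u y))| ≤
        ∫ y, (L ^ 2 + y ^ 2) * |((g' - g : W L) : ℝ → ℝ) y * (cutoff R y * u y)| := by
      rw [← Real.norm_eq_abs]
      refine (norm_integral_le_integral_norm _).trans (le_of_eq (integral_congr_ae (Eventually.of_forall fun y => ?_)))
      show ‖(L ^ 2 + y ^ 2) * (((g' - g : W L) : ℝ → ℝ) y * (cutoff R y * u y))‖ = _
      rw [Real.norm_eq_abs, abs_mul, abs_of_nonneg (by positivity : (0:ℝ) ≤ L ^ 2 + y ^ 2)]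
    rw [norm_W]
    exact h1.trans (hb1.trans (mul_le_mul_of_nonneg_left (Real.sqrt_le_sqrt hχu_le') (Real.sqrt_nonneg _)))
  have habs2 : |∫ y, (L ^ 2 + y ^ 2) * (((1 - cutoff R y) * (g : ℝ → ℝ) y) * (cutoff R y * u y))| ≤
      Real.sqrt (∫ y in {ξ : ℝ | R ^ 2 ≤ ξ ^ 2}, (L ^ 2 + y ^ 2) * (g : ℝ → ℝ) y ^ 2) * Real.sqrt (∫ y, (L ^ 2 + y ^ 2) * u y ^ 2) := by
    have h1 : |∫ y, (L ^ 2 + y ^ 2) * (((1 - cutoff R y) * (g : ℝ → ℝ) y) * (cutoff R y * u y))| ≤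
        ∫ y, (L ^ 2 + y ^ 2) * |((1 - cutoff R y) * (g : ℝ → ℝ) y) * (cutoff R y * u y)| := by
      rw [← Real.norm_eq_abs]
      refine (norm_integral_le_integral_norm _).trans (le_of_eq (integral_congr_ae (Eventually.of_forall fun y => ?_)))
      show ‖(L ^ 2 + y ^ 2) * (((1 - cutoff R y) * (g : ℝ → ℝ) y) * (cutoff R y * u y))‖ = _
      rw [Real.norm_eq_abs, abs_mul, abs_of_nonneg (by positivity : (0:ℝ) ≤ L ^ 2 + y ^ 2)]
    refine h1.trans (hb2.trans ?_)
    exact mul_le_mul (Real.sqrt_le_sqrt htail_le) (Real.sqrt_le_sqrt hχu_le') (Real.sqrt_nonneg _) (Real.sqrt_nonneg _)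
  rw [hsplit]
  calc |(∫ y, (L ^ 2 + y ^ 2) * (((g' - g : W L) : ℝ → ℝ) y * (cutoff R y * u y)))
        + ∫ y, (L ^ 2 + y ^ 2) * (((1 - cutoff R y) * (g : ℝ → ℝ) y) * (cutoff R y * u y))|
      ≤ |∫ y, (L ^ 2 + y ^ 2) * (((g' - g : W L) : ℝ → ℝ) y * (cutoff R y * u y))|
        + |∫ y, (L ^ 2 + y ^ 2) * (((1 - cutoff R y) * (g : ℝ → ℝ) y) * (cutoff R y * u y))| := abs_add_le _ _
    _ ≤ _ := by rw [add_mul]; exact add_le_add habs1 habs2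

end SheetRCutoffApproximation
end Summit.NavierStokesRegularity.OSWSelfSimilar

end
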